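import Summits.CriticalPhenomena.PercolationContinuityZ3.Theorems.PercNearOneGluingNoHeavyLowerTailSahiTransportJR3Tables
import Summits.CriticalPhenomena.PercolationContinuityZ3.Theorems.PercNearOneGluingNoHeavyLowerTailSahiTransportJRSound

/-!
# `NoHeavyLowerTail` (crux stmt-CriticalPhenomena-4575), Sahi / Kahn positivity: three-sample parameter-free certificates — SOUNDNESS (measure part)

Support file (cell `prim-l12`, seat P3, gen 5; `--supports stmt-CriticalPhenomena-4575`).  No `sorry`, no named facts, standard axioms.
The three-sample analogue of `…SahiTransportJRMeasure`: the scaled measure `σ(T) = (1/DEN)·Σ_{η ∉ H ∋ ζ, ξ} ct[η][ζ][ξ][code T]·w(η)w(ζ)w(ξ)` of a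
`Tab3`, its pairing with events, sign, support, total mass `w(Hᶜ)w(H)`, the bounds `0 ≤ massK3 ≤ DEN` and the stochastic-order condition (o).
The row identities and the certificate are in `…SahiTransportJR3Rows` / `…SahiTransportJR3Sound`. [this work]
-/

noncomputable section

open scoped Classical

namespace Summit.CriticalPhenomena.PercolationContinuityZ3.Theorems.SahiTransportJR

open Finset SahiHittingSlot SahiTransportCert SahiC3Cube SahiTransportCheck OneCutCert CovTransferCert Literature.Combinatorics.Sahi2008
open Literature.Probability.Percolation (DeterminedBy)
open Literature.Probability.Percolation.BHK2006 (weight ind_inter)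
open Literature.Probability.Percolation.DecisionTree (ind ind_of_mem ind_of_not_mem ind_nonneg)

variable {m : ℕ}


/-! #### Structural facts of a three-sample table -/

/-- The structural facts recorded by `structTab3`. [this work] -/
structure TabFacts3 (m M : ℕ) (ct : Tab3) : Prop where
  nonneg : ∀ η, η < 2 ^ m → M.testBit η = false → ∀ ζ, ζ < 2 ^ m → M.testBit ζ = true → ∀ ξ, ξ < 2 ^ m → ∀ T, T < 2 ^ m → 0 ≤ get4 ct η ζ ξ T
  supp : ∀ η, η < 2 ^ m → M.testBit η = false → ∀ ζ, ζ < 2 ^ m → M.testBit ζ = true → ∀ ξ, ξ < 2 ^ m → ∀ T, T < 2 ^ m →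
    get4 ct η ζ ξ T ≠ 0 → psub η T = true ∧ M.testBit T = true
  rowsum : ∀ η, η < 2 ^ m → M.testBit η = false → ∀ ζ, ζ < 2 ^ m → M.testBit ζ = true → ∀ ξ, ξ < 2 ^ m →
    ∑ T ∈ Finset.range (2 ^ m), get4 ct η ζ ξ T = (DEN : ℤ)

/-- `structTab3 = true` yields the structural facts. [this work] -/
theorem tabFacts3_of_structTab3 {M : ℕ} {ct : Tab3} (h : structTab3 m M ct = true) : TabFacts3 m M ct := by
  unfold structTab3 at h
  simp only [List.all_eq_true, Bool.and_eq_true, decide_eq_true_eq, Bool.or_eq_true, List.mem_range] at h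
  have key : ∀ η, η < 2 ^ m → M.testBit η = false → ∀ ζ, ζ < 2 ^ m → M.testBit ζ = true → ∀ ξ, ξ < 2 ^ m →
      (∀ T, T < 2 ^ m → 0 ≤ get4 ct η ζ ξ T ∧ (get4 ct η ζ ξ T = 0 ∨ (psub η T = true ∧ M.testBit T = true))) ∧
        ((List.range (2 ^ m)).map fun T => get4 ct η ζ ξ T).sum = (DEN : ℤ) := by
    intro η hη hηD ζ hζ hζH ξ hξ
    have hηm : η ∈ pts m (cpl m M) := mem_pts.2 ⟨hη, by rw [testBit_cpl hη, hηD]; rfl⟩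
    have hζm : ζ ∈ pts m M := mem_pts.2 ⟨hζ, hζH⟩
    exact h η hηm ζ hζm ξ hξ
  refine ⟨fun η hη hD ζ hζ hH ξ hξ T hT => ((key η hη hD ζ hζ hH ξ hξ).1 T hT).1,
    fun η hη hD ζ hζ hH ξ hξ T hT hne => ?_, fun η hη hD ζ hζ hH ξ hξ => ?_⟩
  · rcases ((key η hη hD ζ hζ hH ξ hξ).1 T hT).2 with h0 | h1
    · exact (hne h0).elim
    · exact h1
  · rw [← sum_map_range]; exact (key η hη hD ζ hζ hH ξ hξ).2

/-! #### The scaled measure of a three-sample table -/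

/-- The SCALED TRANSPORT MEASURE of a three-sample table. [this work] -/
def sg3 (m M : ℕ) (ct : Tab3) (q : Fin m → unitInterval) (T : Set (Fin m)) : ℝ :=
  (∑ η ∈ Finset.range (2 ^ m), ∑ ζ ∈ Finset.range (2 ^ m), ∑ ξ ∈ Finset.range (2 ^ m),
    if M.testBit η = false ∧ M.testBit ζ = true then
      (get4 ct η ζ ξ (code T) : ℝ) * (mlM m (2 ^ η) (xq q) * mlM m (2 ^ ζ) (xq q) * mlM m (2 ^ ξ) (xq q)) else 0) / DEN

/-- Pairing the scaled measure with an event. [this work] -/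
theorem sum_sg3_mul_ind (M : ℕ) (ct : Tab3) (q : Fin m → unitInterval) (𝒴 : Set (Set (Fin m))) :
    (DEN : ℝ) * ∑ T, sg3 m M ct q T * ind 𝒴 T =
      ∑ η ∈ Finset.range (2 ^ m), ∑ ζ ∈ Finset.range (2 ^ m), ∑ ξ ∈ Finset.range (2 ^ m),
        if M.testBit η = false ∧ M.testBit ζ = true then
          (∑ t ∈ Finset.range (2 ^ m), if (encA m 𝒴).testBit t = true then (get4 ct η ζ ξ t : ℝ) else 0) *
            (mlM m (2 ^ η) (xq q) * mlM m (2 ^ ζ) (xq q) * mlM m (2 ^ ξ) (xq q)) else 0 := by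
  rw [Finset.mul_sum]
  have h1 : ∀ T, (DEN : ℝ) * (sg3 m M ct q T * ind 𝒴 T) =
      ∑ η ∈ Finset.range (2 ^ m), ∑ ζ ∈ Finset.range (2 ^ m), ∑ ξ ∈ Finset.range (2 ^ m),
        if M.testBit η = false ∧ M.testBit ζ = true then
          ((get4 ct η ζ ξ (code T) : ℝ) * ind 𝒴 T) * (mlM m (2 ^ η) (xq q) * mlM m (2 ^ ζ) (xq q) * mlM m (2 ^ ξ) (xq q)) else 0 := by
    intro T
    unfold sg3
    rw [div_mul_eq_mul_div, mul_div_cancel₀ _ DEN_pos.ne', Finset.sum_mul]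
    refine Finset.sum_congr rfl fun η _ => ?_
    rw [Finset.sum_mul]
    refine Finset.sum_congr rfl fun ζ _ => ?_
    rw [Finset.sum_mul]
    refine Finset.sum_congr rfl fun ξ _ => ?_
    split_ifs <;> ring
  simp_rw [h1]
  rw [Finset.sum_comm]
  refine Finset.sum_congr rfl fun η _ => ?_
  rw [Finset.sum_comm]
  refine Finset.sum_congr rfl fun ζ _ => ?_
  rw [Finset.sum_comm]
  refine Finset.sum_congr rfl fun ξ _ => ?_
  by_cases hc : M.testBit η = false ∧ M.testBit ζ = true
  · simp only [if_pos hc]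
    rw [← Finset.sum_mul, sum_eq_sum_range (fun T => (get4 ct η ζ ξ (code T) : ℝ) * ind 𝒴 T)]
    congr 1
    refine Finset.sum_congr rfl fun t ht => ?_
    rw [code_pt (Finset.mem_range.1 ht), ind_pt_eq 𝒴 (Finset.mem_range.1 ht)]
    split_ifs <;> simp
  · simp only [if_neg hc, Finset.sum_const_zero]

/-- The scaled measure is nonnegative. [this work] -/
theorem sg3_nonneg {M : ℕ} {ct : Tab3} (hf : TabFacts3 m M ct) (q : Fin m → unitInterval) (T : Set (Fin m)) : 0 ≤ sg3 m M ct q T := by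
  unfold sg3
  refine div_nonneg (Finset.sum_nonneg fun η hη => Finset.sum_nonneg fun ζ hζ => Finset.sum_nonneg fun ξ hξ => ?_) DEN_pos.le
  split_ifs with hc
  · exact mul_nonneg (by exact_mod_cast hf.nonneg η (Finset.mem_range.1 hη) hc.1 ζ (Finset.mem_range.1 hζ) hc.2 ξ (Finset.mem_range.1 hξ) _ (code_lt T))
      (mul_nonneg (mul_nonneg (mlM_nonneg _ (inCube_xq q)) (mlM_nonneg _ (inCube_xq q))) (mlM_nonneg _ (inCube_xq q)))
  · exact le_rfl

/-- The scaled measure vanishes off `H`. [this work] -/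
theorem sg3_eq_zero {M : ℕ} {ct : Tab3} (hf : TabFacts3 m M ct) (q : Fin m → unitInterval) {T : Set (Fin m)}
    (hT : M.testBit (code T) = false) : sg3 m M ct q T = 0 := by
  unfold sg3
  rw [Finset.sum_eq_zero, zero_div]
  intro η hη
  refine Finset.sum_eq_zero fun ζ hζ => Finset.sum_eq_zero fun ξ hξ => ?_
  split_ifs with hc
  · have : get4 ct η ζ ξ (code T) = 0 := by
      by_contra hne
      have := (hf.supp η (Finset.mem_range.1 hη) hc.1 ζ (Finset.mem_range.1 hζ) hc.2 ξ (Finset.mem_range.1 hξ) _ (code_lt T) hne).2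
      rw [hT] at this; exact Bool.false_ne_true this
    rw [this]; simp
  · rfl

/-- `Σ_{ξ<2^m} w(pt ξ) = 1`. [this work] -/
theorem sum_mlM_pow (q : Fin m → unitInterval) : ∑ ξ ∈ Finset.range (2 ^ m), mlM m (2 ^ ξ) (xq q) = 1 := by
  have h : ∀ t, t < 2 ^ m → ((fullN m).testBit t = true ↔ pt m t ∈ (Set.univ : Set (Set (Fin m)))) := fun t ht => by
    unfold fullN; rw [Nat.testBit_two_pow_sub_one]; simp [ht]
  have := sum_bit_mlM q h
  rw [pr_univ] at this
  rw [← this]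
  refine Finset.sum_congr rfl fun t ht => ?_
  rw [if_pos ((h t (Finset.mem_range.1 ht)).2 (Set.mem_univ _))]

/-- **Total mass**: `Σ_T σ(T) = w(Hᶜ)·w(H)`. [this work] -/
theorem sum_sg3 {M : ℕ} {ct : Tab3} {P : Set (Set (Fin m))} (hPM : ∀ x, x < 2 ^ m → (M.testBit x = true ↔ pt m x ∈ P))
    (hf : TabFacts3 m M ct) (q : Fin m → unitInterval) : ∑ T, sg3 m M ct q T = pr q Pᶜ * pr q P := by
  have h := sum_sg3_mul_ind (m := m) M ct q Set.univ
  have hfull : ∀ t, t < 2 ^ m → (encA m (Set.univ : Set (Set (Fin m)))).testBit t = true := fun t ht => by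
    rw [testBit_encA]; simp [ht]
  have hind : ∑ T, sg3 m M ct q T * ind (Set.univ : Set (Set (Fin m))) T = ∑ T, sg3 m M ct q T :=
    Finset.sum_congr rfl fun T _ => by rw [ind_of_mem (Set.mem_univ T), mul_one]
  rw [hind] at h
  have h2 : (DEN : ℝ) * ∑ T, sg3 m M ct q T = (DEN : ℝ) *
      (((∑ η ∈ Finset.range (2 ^ m), if (cpl m M).testBit η = true then mlM m (2 ^ η) (xq q) else 0) *
        (∑ ζ ∈ Finset.range (2 ^ m), if M.testBit ζ = true then mlM m (2 ^ ζ) (xq q) else 0)) *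
        (∑ ξ ∈ Finset.range (2 ^ m), mlM m (2 ^ ξ) (xq q))) := by
    rw [h, Finset.sum_mul_sum, Finset.sum_mul, Finset.mul_sum]
    refine Finset.sum_congr rfl fun η hη => ?_
    rw [Finset.sum_mul, Finset.mul_sum]
    refine Finset.sum_congr rfl fun ζ hζ => ?_
    rw [Finset.mul_sum, Finset.mul_sum]
    refine Finset.sum_congr rfl fun ξ hξ => ?_
    have hη' := Finset.mem_range.1 hη
    rw [testBit_cpl hη']
    by_cases hc : M.testBit η = false ∧ M.testBit ζ = true
    · have hrow := hf.rowsum η hη' hc.1 ζ (Finset.mem_range.1 hζ) hc.2 ξ (Finset.mem_range.1 hξ)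
      have hin : (∑ t ∈ Finset.range (2 ^ m), if (encA m (Set.univ : Set (Set (Fin m)))).testBit t = true then (get4 ct η ζ ξ t : ℝ) else 0)
          = DEN := by
        rw [Finset.sum_congr rfl fun t ht => if_pos (hfull t (Finset.mem_range.1 ht))]
        exact_mod_cast hrow
      rw [if_pos hc, hin]
      simp [hc.1, hc.2]
    · rw [if_neg hc]
      rcases not_and_or.1 hc with h1 | h1
      · have h1' : M.testBit η = true := by cases hb : M.testBit η <;> simp_all
        simp [h1']
      · simp [h1]
  have h3 := sum_bit_mlM q (cpl_spec hPM)
  have h4 := sum_bit_mlM q hPM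
  rw [h3, h4, sum_mlM_pow, mul_one] at h2
  exact mul_left_cancel₀ DEN_pos.ne' h2

/-! #### Mass bounds and the stochastic-order condition -/

/-- `massK3` as an indicator sum. [this work] -/
theorem massK3_eq_sum (M : ℕ) (ct : Tab3) (K η ζ ξ : ℕ) :
    massK3 m M ct K η ζ ξ = ∑ t ∈ Finset.range (2 ^ m), if (M &&& K).testBit t = true then get4 ct η ζ ξ t else 0 := by
  unfold massK3; rw [sum_pts]

/-- `0 ≤ massK3 ≤ DEN` on the relevant rows. [this work] -/
theorem massK3_bounds {M : ℕ} {ct : Tab3} (hf : TabFacts3 m M ct) (K : ℕ) {η ζ ξ : ℕ} (hη : η < 2 ^ m) (hD : M.testBit η = false)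
    (hζ : ζ < 2 ^ m) (hH : M.testBit ζ = true) (hξ : ξ < 2 ^ m) : 0 ≤ massK3 m M ct K η ζ ξ ∧ massK3 m M ct K η ζ ξ ≤ DEN := by
  rw [massK3_eq_sum, ← hf.rowsum η hη hD ζ hζ hH ξ hξ]
  constructor
  · exact Finset.sum_nonneg fun t ht => by
      split_ifs
      · exact hf.nonneg η hη hD ζ hζ hH ξ hξ t (Finset.mem_range.1 ht)
      · exact le_rfl
  · exact Finset.sum_le_sum fun t ht => by
      split_ifs
      · exact le_rfl
      · exact hf.nonneg η hη hD ζ hζ hH ξ hξ t (Finset.mem_range.1 ht)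

/-- For a relevant row, the `M`-bit in `massK3` is redundant. [this work] -/
theorem massK3_eq_sum' {M : ℕ} {ct : Tab3} (hf : TabFacts3 m M ct) (K : ℕ) {η ζ ξ : ℕ} (hη : η < 2 ^ m) (hD : M.testBit η = false)
    (hζ : ζ < 2 ^ m) (hH : M.testBit ζ = true) (hξ : ξ < 2 ^ m) :
    massK3 m M ct K η ζ ξ = ∑ t ∈ Finset.range (2 ^ m), if K.testBit t = true then get4 ct η ζ ξ t else 0 := by
  rw [massK3_eq_sum]
  refine Finset.sum_congr rfl fun t ht => ?_
  rw [Nat.testBit_land]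
  by_cases hK : K.testBit t = true
  · rw [hK, Bool.and_true, if_pos rfl]
    by_cases hM : M.testBit t = true
    · rw [if_pos hM]
    · rw [if_neg hM]
      by_contra hne
      exact hM (hf.supp η hη hD ζ hζ hH ξ hξ t (Finset.mem_range.1 ht) (Ne.symm hne)).2
  · rw [if_neg hK, Bool.eq_false_iff.2 hK, Bool.and_false]; simp

/-- `massK3` at a point mask is the table entry. [this work] -/
theorem massK3_pow {M : ℕ} {ct : Tab3} (hf : TabFacts3 m M ct) {t η ζ ξ : ℕ} (ht : t < 2 ^ m) (hη : η < 2 ^ m) (hD : M.testBit η = false)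
    (hζ : ζ < 2 ^ m) (hH : M.testBit ζ = true) (hξ : ξ < 2 ^ m) : massK3 m M ct (2 ^ t) η ζ ξ = get4 ct η ζ ξ t := by
  rw [massK3_eq_sum' hf (2 ^ t) hη hD hζ hH hξ]
  have : ∀ t' ∈ Finset.range (2 ^ m), (if (2 ^ t).testBit t' = true then get4 ct η ζ ξ t' else 0) = if t = t' then get4 ct η ζ ξ t' else 0 := by
    intro t' _; rw [Nat.testBit_two_pow]; by_cases h : t = t' <;> simp [h]
  rw [Finset.sum_congr rfl this, Finset.sum_ite_eq, if_pos (Finset.mem_range.2 ht)]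

/-- **(o)** for a three-sample table: `θ·w(Hᶜ ∩ 𝒯) ≤ Σ_T σ(T)·1_𝒯(T)` for every up-set `𝒯`. [this work] -/
theorem stoch3_of_tabFacts {M : ℕ} {ct : Tab3} {P : Set (Set (Fin m))} (hPM : ∀ x, x < 2 ^ m → (M.testBit x = true ↔ pt m x ∈ P))
    (hf : TabFacts3 m M ct) (q : Fin m → unitInterval) {𝒯 : Set (Set (Fin m))} (h𝒯 : IsUpperSet 𝒯) :
    pr q P * pr q (Pᶜ ∩ 𝒯) ≤ ∑ T, sg3 m M ct q T * ind 𝒯 T := by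
  have hmain := sum_sg3_mul_ind (m := m) M ct q 𝒯
  have hinner : ∀ η, η < 2 ^ m → M.testBit η = false → (encA m 𝒯).testBit η = true → ∀ ζ, ζ < 2 ^ m → M.testBit ζ = true → ∀ ξ, ξ < 2 ^ m →
      (∑ t ∈ Finset.range (2 ^ m), if (encA m 𝒯).testBit t = true then (get4 ct η ζ ξ t : ℝ) else 0) = DEN := by
    intro η hη hD hηT ζ hζ hH ξ hξ
    have hrow := hf.rowsum η hη hD ζ hζ hH ξ hξ
    have : ∀ t ∈ Finset.range (2 ^ m), (if (encA m 𝒯).testBit t = true then (get4 ct η ζ ξ t : ℝ) else 0) = (get4 ct η ζ ξ t : ℝ) := by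
      intro t ht
      by_cases hz : get4 ct η ζ ξ t = 0
      · rw [hz]; simp
      · have hsub := (hf.supp η hη hD ζ hζ hH ξ hξ t (Finset.mem_range.1 ht) hz).1
        have hηT' : pt m η ∈ 𝒯 := by
          have := hηT; rw [testBit_encA] at this; simpa [hη] using this
        have htT : pt m t ∈ 𝒯 := h𝒯 (pt_subset_of_psub hsub) hηT'
        rw [if_pos (by rw [testBit_encA]; simp [Finset.mem_range.1 ht, htT])]
    rw [Finset.sum_congr rfl this]; exact_mod_cast hrow
  have hlow : (DEN : ℝ) * (pr q P * pr q (Pᶜ ∩ 𝒯)) ≤ (DEN : ℝ) * ∑ T, sg3 m M ct q T * ind 𝒯 T := by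
    rw [hmain]
    have hsplit : (DEN : ℝ) * (pr q P * pr q (Pᶜ ∩ 𝒯)) =
        ∑ η ∈ Finset.range (2 ^ m), ∑ ζ ∈ Finset.range (2 ^ m), ∑ ξ ∈ Finset.range (2 ^ m),
          if (cpl m M &&& encA m 𝒯).testBit η = true ∧ M.testBit ζ = true then
            (DEN : ℝ) * (mlM m (2 ^ η) (xq q) * mlM m (2 ^ ζ) (xq q) * mlM m (2 ^ ξ) (xq q)) else 0 := by
      have h1 := sum_bit_mlM q hPM
      have h2 : ∀ t, t < 2 ^ m → ((cpl m M &&& encA m 𝒯).testBit t = true ↔ pt m t ∈ Pᶜ ∩ 𝒯) := by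
        intro t ht
        rw [Nat.testBit_land, Bool.and_eq_true, cpl_spec hPM t ht, testBit_encA, Set.mem_inter_iff]
        simp [ht]
      have h3 := sum_bit_mlM q h2
      have h5 := sum_mlM_pow (m := m) q
      have hprod : (DEN : ℝ) * (pr q P * pr q (Pᶜ ∩ 𝒯)) = (DEN : ℝ) * (pr q (Pᶜ ∩ 𝒯) * pr q P * ∑ ξ ∈ Finset.range (2 ^ m), mlM m (2 ^ ξ) (xq q)) := by
        rw [h5]; ring
      rw [hprod, ← h1, ← h3, Finset.sum_mul_sum, Finset.sum_mul, Finset.mul_sum]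
      refine Finset.sum_congr rfl fun η _ => ?_
      rw [Finset.sum_mul, Finset.mul_sum]
      refine Finset.sum_congr rfl fun ζ _ => ?_
      rw [Finset.mul_sum, Finset.mul_sum]
      refine Finset.sum_congr rfl fun ξ _ => ?_
      by_cases ha : (cpl m M &&& encA m 𝒯).testBit η = true
      · by_cases hb : M.testBit ζ = true
        · rw [if_pos ha, if_pos hb, if_pos ⟨ha, hb⟩]
        · rw [if_neg hb, if_neg (c := (cpl m M &&& encA m 𝒯).testBit η = true ∧ M.testBit ζ = true) (fun h => hb h.2)]; ring
      · rw [if_neg ha, if_neg (c := (cpl m M &&& encA m 𝒯).testBit η = true ∧ M.testBit ζ = true) (fun h => ha h.1)]; ring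
    rw [hsplit]
    refine Finset.sum_le_sum fun η hη => Finset.sum_le_sum fun ζ hζ => Finset.sum_le_sum fun ξ hξ => ?_
    have hη' := Finset.mem_range.1 hη; have hζ' := Finset.mem_range.1 hζ; have hξ' := Finset.mem_range.1 hξ
    have hm3 : 0 ≤ mlM m (2 ^ η) (xq q) * mlM m (2 ^ ζ) (xq q) * mlM m (2 ^ ξ) (xq q) :=
      mul_nonneg (mul_nonneg (mlM_nonneg _ (inCube_xq q)) (mlM_nonneg _ (inCube_xq q))) (mlM_nonneg _ (inCube_xq q))
    by_cases hc : M.testBit η = false ∧ M.testBit ζ = true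
    · rw [if_pos hc]
      by_cases hηT : (encA m 𝒯).testBit η = true
      · rw [hinner η hη' hc.1 hηT ζ hζ' hc.2 ξ hξ']
        split_ifs
        · exact le_rfl
        · exact mul_nonneg DEN_pos.le hm3
      · have : ¬ ((cpl m M &&& encA m 𝒯).testBit η = true ∧ M.testBit ζ = true) := by
          rw [Nat.testBit_land, Bool.and_eq_true]; exact fun h => hηT h.1.2
        rw [if_neg this]
        exact mul_nonneg (Finset.sum_nonneg fun t ht => by
          split_ifs
          · exact_mod_cast hf.nonneg η hη' hc.1 ζ hζ' hc.2 ξ hξ' t (Finset.mem_range.1 ht)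
          · exact le_rfl) hm3
    · rw [if_neg hc]
      have : ¬ ((cpl m M &&& encA m 𝒯).testBit η = true ∧ M.testBit ζ = true) := by
        rw [Nat.testBit_land, Bool.and_eq_true, testBit_cpl hη']
        intro h
        apply hc
        refine ⟨?_, h.2⟩
        cases hb : M.testBit η
        · rfl
        · rw [hb] at h; exact absurd h.1.1 (by decide)
      rw [if_neg this]
  exact le_of_mul_le_mul_left hlow DEN_pos

end Summit.CriticalPhenomena.PercolationContinuityZ3.Theorems.SahiTransportJR
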